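import Summits.BirchSwinnertonDyer.BirchSwinnertonDyer.Theorems.Rank1ResidualX1RankZeroTwist
import Summits.BirchSwinnertonDyer.Rank1Residual.X2.RankZeroExact
import Summits.BirchSwinnertonDyer.Rank1Residual.X2.RankOneManin
import Summits.BirchSwinnertonDyer.Rank1Residual.X2.IsogenyClassStability
import Summits.BirchSwinnertonDyer.Rank1Residual.X1.RankZeroGrossZagierTwist
import Summits.BirchSwinnertonDyer.Rank1Residual.X1.RankZeroPartner
import Summits.BirchSwinnertonDyer.Rank1Residual.X11b.BDPRouteDescent
import Summits.BirchSwinnertonDyer.Rank1Residual.AdditivePotMult.RankOneHeegnerAnyPrime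
import Summits.BirchSwinnertonDyer.Rank1Residual.AdditivePotMult.QuadraticTorsionValuation
import Literature.NumberTheory.EllipticCurves.Rank1Residual.Typed.Basic
import HarnessLib

/-!
# Crux `MazurMCOnCellB` (stmt-BirchSwinnertonDyer-19033) — the twist-back road's two open inputs
# cut to ONE INEQUALITY EACH: STEP L over `K` in the rank-zero orientation (`X11b.IndexLowerBoundAt`,
# ONE divisibility) and the UPPER half of `BSD(p)` at the rank-one twist (`MissingUpperBoundAt`)

LEAD bsd-line-x2-p1 g7 (2026-08-28); fourth file of the twist-back door (p622525 `…Twistback`,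
p623232 `…TwistbackRemainder`, p623836 `…TwistbackDisplay`). p623836 §2 proved the crux BY NAME from
the rank-ZERO Heegner-index IDENTITY over `K` (`X11b.IndexIdentityAt`, the anticyclotomic main
conjecture read in BOTH divisibilities + control + BDP) and FULL `BSDp` on X2c ∩ `GVPar`. Both inputs
are used there through an EQUALITY of `p`-adic valuations. But the crux at an X2b pair is Mazur's
main conjecture at an odd multiplicative prime with `E[p]` reducible and `ord_{s=1} L(E,s) = 0`, and
there the tree already knows (`X2/RankZeroExact.lean`, Wuthrich 2014 Thm. 16 = the divisibility
`char X(E/ℚ_∞) ∣ L_p(E)`) that the main conjecture is EQUIVALENT to the LOWER half alone: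
`ord_p (L(E,1)/Ω_E) ≤ ord_p (#Ш(E) · ∏ c_ℓ / #E(ℚ)_tors²)` (`X2.mazurMainConjectureAt_of_padicValRat_le_of_red`).
An inequality needs only inequalities. THIS FILE:

* §1 `displayLE_of_indexLowerBoundAt` — CLASS-AGNOSTIC Gross–Zagier bookkeeping at ONE Heegner datum,
  the inequality twin of p623836 §1 `displaySwap_of_indexIdentityAt`: for `W/ℚ` globally minimal of
  conductor `N` with `ord_{s=1} L(E,s) = 0`, `K` admissible (Heegner for `N`, `p` split, `d_K` odd
  `< -4`), a parametrisation datum with `p ∤ c` and its Heegner point `P`, a globally minimal model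
  `Wd` of `E^{(d_K)}` with `ord_{s=1} L = 1`: STEP L over `K` — `X11b.IndexLowerBoundAt W p K P`,
  `2·ord_p [E(K):ℤP] ≤ ord_p #Ш(E/K) + 2·ord_p ∏ c_ℓ(E/ℚ)` (JSW 2017 (eq:shalowerK-1) / Castella 2018
  (1.1): control + ONE divisibility of the anticyclotomic main conjecture + BDP) — granted `Ш(E/K)`
  finite (Kolyvagin) ⟹ the JOINT lower inequality
  `[ord_p q − B(E)] + [ord_p q_d − B(E^K)] ≤ 0`, `B(·) = ord_p #Ш + ord_p ∏c − 2·ord_p #tors`,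
  `q = L(E,1)/Ω_E`, `q_d = L'(Wd,1)/(Ω·Reg)`. Proof: `TwistIdentity.padicValRat_add_eq_of_grossZagier_swap`
  (CGLS (5.6), ranks exchanged) + the odd parts under `K/ℚ` of `Ш`, torsion, Tamagawa — verbatim the
  lemmas of p623836 §1, with `≤` for `=` at the end.
* §2 `mazurMainConjectureAt_of_indexLowerBoundAt_of_upper_twist` — PER PAIR: an X2b-type pair (`p ≠ 2`
  multiplicative, `E[p]` reducible, `r_an = 0`) with such data, STEP L over `K` in the rank-zero
  orientation, and the UPPER half of `BSD(p)` at the rank-one twist in Miller's currency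
  (`Typed.MissingUpperBoundAt Wd p`: `ord_p #Ш(Wd) ≤ ord_p #Ш_an(Wd)` — the Euler-system / Kato–Kolyvagin
  direction; the μ-side / Greenberg–Vatsal direction at the twist is NOT used) ⟹
  `X2.MazurMainConjectureAt W p`. No `BSDp` of anything is assumed.
* The class-wide consumers (the crux BY NAME from `PublishedInputs` + BFH + [STEP L in the rank-zero
  orientation] + [the upper half on X2c ∩ `GVPar`], and the comparison with p623836 §2) are the
  companion file `…TwistbackLowerHalfByName.lean`.

Net: row A10's open content on the twist-back road is [ONE anticyclotomic divisibility at `p ‖ N`,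
rank-zero orientation — the SAME typed predicate `X11b.IndexLowerBoundAt` that is route p2's STEP L on
the irreducible twin class X11b] + [the Kato–Kolyvagin half of `BSD(p)` on X2c ∩ `GVPar`]. In the
cell's joint currency (`Typed.JointLowerBoundAt`, `Typed.missingLowerBoundAt_of_joint_of_upper`) this is
the rank-ZERO-orientation twin of the additive cell's
`Route3Anticyc.missingLowerBoundAt_rankOne_of_heegnerInput`.

HONEST FRAMING: nothing here proves a main conjecture or BSD for any curve; STEP L at `p ‖ N` for
reducible `E[p]` is NOT in print (Keller–Yin Thm. D / §7 are PREPRINT, Castella's BDP formula at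
`p ‖ N` is `p ≥ 5`, the assembly is printed nowhere), the upper half on X2c ∩ `GVPar` is open
(per pair it follows from `BSDp`, class-wide from GV-MC + Schneider + `p`-adic Gross–Zagier); they
and the published binders (Wuthrich Thm. 16, Stein–Wuthrich Thm. 6.1, Greenberg–Stevens, GZK,
Gross–Zagier, Kolyvagin, modularity) are hypotheses BY NAME. 0 cells / 0 labels / 0 stubs move;
skeleton `mudescent` v4 untouched. Does NOT import the route file (its consumers do); route-independent
modules only.

References: [JetchevSkinnerWan2017] §7.4.1 (eq:shalowerK-1); [Castella2018] (1.1), (5.3);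
[CastellaEtAl2021] proof of Thm. 5.3.1, (5.5)–(5.7); [GrossZagier1986] I.(6.5), V.§2;
[KellerYin2024] Thm. D, §7; [Wuthrich2014] Thm. 16, Prop. 21; [GreenbergLNM1716] §4;
[Miller2011LMS] Def. 1.1.
-/

set_option autoImplicit false

-- `Summit.BirchSwinnertonDyer.BirchSwinnertonDyer.…`: the summit and its single sub-problem share a name.
set_option linter.dupNamespace false

noncomputable section

open scoped Classical MatrixGroups ModularForm

open CongruenceSubgroup WeierstrassCurve NumberField
  Literature.NumberTheory.EllipticCurves
  Literature.NumberTheory.EllipticCurves.ModularForms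
  Literature.NumberTheory.QuadraticFields
  Literature.NumberTheory.EllipticCurves.KrizLi2019
  Literature.NumberTheory.EllipticCurves.Rank1Residual
  Literature.NumberTheory.EllipticCurves.Rank1Residual.Typed
  Literature.NumberTheory.EllipticCurves.Wuthrich2014
  Literature.NumberTheory.EllipticCurves.SteinWuthrich2013
  Literature.NumberTheory.EllipticCurves.GreenbergVatsal2000
  Summit.BirchSwinnertonDyer.Rank1Residual
  Summit.BirchSwinnertonDyer.BirchSwinnertonDyer.Theorems.Rank1ResidualX1RankZeroTwist

namespace Summit.BirchSwinnertonDyer.BirchSwinnertonDyer.Theorems.EisensteinPrimesMazurMCOnCellBTwistbackLowerHalf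

/-! ## §1. The joint lower inequality from STEP L over `K`, rank-zero orientation (class-agnostic) -/

/-- **STEP L over `K` at one Heegner datum ⟹ the joint lower inequality over the pair `(E, E^{(d_K)})`,
rank-ZERO orientation.** Data: `W/ℚ` globally minimal of conductor `N`, `ord_{s=1} L(E,s) = 0`, `p ≠ 2`;
`K` imaginary quadratic, `d_K` odd `< -4`, Heegner hypothesis for `N`, `p` split; `Dt` a parametrisation
datum of level `N` with `p ∤ c(Dt)`, `H` a Heegner datum, `P ∈ E(K)` its Heegner point; `Wd` a globally
minimal model of `E^{(d_K)}` with `ord_{s=1} L = 1`; `q = L(E,1)/Ω_E`, `q_d = L'(Wd,1)/(Ω·Reg)`. Inputs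
by name: Gross–Zagier (`hGZ`), Kolyvagin (`hKo`), GZK, modularity. If `X11b.IndexLowerBoundAt W p K P`
holds (granted `Ш(E/K)` finite), then
`[ord_p q − (ord_p #Ш(E) + ord_p ∏c(E) − 2 ord_p #E(ℚ)_tors)] + [ord_p q_d − (ord_p #Ш(Wd) + ord_p ∏c(Wd) − 2 ord_p #Wd(ℚ)_tors)] ≤ 0`.
Proof: `TwistIdentity.padicValRat_add_eq_of_grossZagier_swap` (`ord_p q + ord_p q_d = 2 ord_p I − 2 ord_p c − 2 ord_p #E(K)_tors`),
STEP L (`2 ord_p I ≤ ord_p #Ш(E/K) + 2 ord_p ∏c(E)`), and the odd parts under `K/ℚ` of `Ш`, torsion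
and Tamagawa numbers. [cite: JetchevSkinnerWan2017, §7.4.1 (eq:shalowerK-1), p. 30 of arXiv:1512.06894]
[cite: CastellaEtAl2021, proof of Thm. 5.3.1, (5.5)–(5.7)] [cite: GrossZagier1986, I.(6.5) and V.§2 (pp. 310–312)] -/
theorem displayLE_of_indexLowerBoundAt
    (W : WeierstrassCurve ℚ) [W.IsElliptic] [W.IsGloballyMinimal] (p : ℕ) [Fact p.Prime]
    (N : ℕ) [NeZero N] (K : Type) [Field K] [NumberField K]
    (Dt : ModularParametrizationData W N) (H : HeegnerDatum N (NumberField.discr K)) (ι : K →+* ℂ)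
    (P : (W.baseChange K).toAffine.Point)
    (hGZ : gross_zagier N W K) (hKo : kolyvagin N W K)
    (hGZK : rank_eq_analyticRank_of_analyticRank_le_one) (hmod : hasEntireLFunction_rat)
    (hK : IsImaginaryQuadratic K) (hodd : Odd (NumberField.discr K)) (hlt : NumberField.discr K < -4)
    (hN : W.conductorNorm ℤ = N) (hHN : SatisfiesHeegnerHypothesis N K)
    (hHp : SatisfiesHeegnerHypothesis p K)
    (hP : WeierstrassCurve.Affine.Point.map ι.toRatAlgHom P = heegnerPointComplex Dt H)
    (hp2 : p ≠ 2) (hc : ¬ (p : ℤ) ∣ Dt.c) (hr : W.analyticRank = 0)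
    (Wd : WeierstrassCurve ℚ) [Wd.IsElliptic] [Wd.IsGloballyMinimal]
    (hWd : ∃ C : VariableChange ℚ, C • Wd = W.quadraticTwist (NumberField.discr K : ℚ))
    (hrd : Wd.analyticRank = 1)
    (hlow : Finite (W.baseChange K).sha → X11b.IndexLowerBoundAt W p K P)
    (q qd : ℚ) (hq : W.entireLFunction 1 / (W.realPeriodRat : ℂ) = (q : ℂ))
    (hqd : Wd.leadingLCoeff / ((Wd.realPeriodRat * Wd.regulator : ℝ) : ℂ) = (qd : ℂ)) :
    (padicValRat p q - ((padicValNat p W.shaOrder : ℤ) + padicValNat p W.tamagawaProduct -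
        2 * padicValNat p W.torsionOrder)) +
      (padicValRat p qd - ((padicValNat p Wd.shaOrder : ℤ) + padicValNat p Wd.tamagawaProduct -
        2 * padicValNat p Wd.torsionOrder)) ≤ 0 := by
  have hpp : p.Prime := Fact.out
  haveI hEK : (W.baseChange K).IsElliptic := isElliptic_baseChange' W K
  have h2 : Module.finrank ℚ K = 2 := hK.1
  have hHN' : SatisfiesHeegnerHypothesis (W.conductorNorm ℤ) K := by rw [hN]; exact hHN
  have hD0 : (NumberField.discr K : ℚ) ≠ 0 := by exact_mod_cast NumberField.discr_ne_zero K
  haveI hEt : (W.quadraticTwist (NumberField.discr K : ℚ)).IsElliptic := W.isElliptic_quadraticTwist hD0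
  -- the inverse change of variables `Cd • E^{(d_K)} = Wd`
  obtain ⟨C, hC⟩ := hWd
  set Cd : VariableChange ℚ := C⁻¹ with hCd_def
  have hCd : Cd • W.quadraticTwist (NumberField.discr K : ℚ) = Wd := by rw [← hC, inv_smul_smul]
  -- `p ∤ d_K` (split), `p ∤ w_K = 2`, `ord_p u(Cd) = 0`
  have hpd : ¬ (p : ℤ) ∣ NumberField.discr K := not_dvd_discr_of_split hK hpp hp2 hHp
  have hμ : ¬ p ∣ Units.torsionOrder K := X2.not_dvd_unitsTorsionOrder_of_discr_lt hK hlt hpp hp2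
  have hu : padicValRat p (Cd.u : ℚ) = 0 :=
    AdditivePotMult.padicValRat_u_eq_zero_of_twist_minimal_of_split W p K hK hHp Cd hCd
  ---------------------------------------------------------------- Kolyvagin: `Ш(E/K)` finite
  have hLt' : (W.quadraticTwist (NumberField.discr K : ℚ)).entireLFunction = Wd.entireLFunction := by
    rw [← hCd, entireLFunction_smul]
  have hL0d : Wd.entireLFunction 1 = 0 := entireLFunction_one_eq_zero_of_analyticRank_eq_one hrd
  obtain ⟨-, hderivd⟩ := leadingLCoeff_eq_deriv_of_analyticRank_eq_one hrd
  have hLt0 : (W.quadraticTwist (NumberField.discr K : ℚ)).entireLFunction 1 = 0 := by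
    rw [hLt']; exact hL0d
  have hprod : LDerivEK W K = W.entireLFunction 1 * deriv Wd.entireLFunction 1 := by
    rw [AdditivePotMult.lDerivEK_eq_mul_deriv W K hmod hLt0, hLt']
  have hLW : W.entireLFunction 1 ≠ 0 := (W.analyticRank_eq_zero_iff_holds (hmod W)).1 hr
  have hLK : LDerivEK W K ≠ 0 := by
    rw [hprod]; exact mul_ne_zero hLW hderivd
  have hPH : IsHeegnerPoint N W K P := ⟨Dt, H, ι, hP⟩
  have hPinf : ¬ IsOfFinAddOrder P :=
    (lDerivEK_ne_zero_iff_not_isOfFinAddOrder W N K hGZ hK hHN hPH).mp hLK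
  obtain ⟨-, hShaK⟩ := hKo hK hHN hPH hPinf
  haveI hfinK : Finite (W.baseChange K).sha := hShaK
  haveI hfinW : Finite W.sha := Literature.NumberTheory.EllipticCurves.shaFinite_of_baseChange W K hShaK
  obtain ⟨-, hShad⟩ := hGZK Wd (by omega)
  haveI hfinSd : Finite Wd.sha := hShad
  ---------------------------------------------------------------- STEP L over `K`
  have hKL := hlow hfinK
  unfold X11b.IndexLowerBoundAt at hKL
  ---------------------------------------------------------------- (5.6) `p`-adically, ranks exchanged
  have h6 := TwistIdentity.padicValRat_add_eq_of_grossZagier_swap W p N K Dt H ι P hGZ hKo hGZK hmod hK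
    hHN hP hp2 hμ hr Wd Cd hCd hu hrd q qd hq hqd
  ---------------------------------------------------------------- the odd parts under `K/ℚ`
  -- `Ш`: `v_p(#Ш(E/K)) = v_p(#Ш(E)) + v_p(#Ш(E^K))`
  have hsha : padicValNat p (W.baseChange K).shaOrder =
      padicValNat p W.shaOrder + padicValNat p Wd.shaOrder := by
    have hcard := card_primaryComponent_sha_baseChange_quadratic_of_odd_of_finite W K h2 Wd
      ⟨Cd, hCd⟩ (W.baseChange K) ⟨1, one_smul _ _⟩ p hp2
    rw [WeierstrassCurve.shaOrder, WeierstrassCurve.shaOrder, WeierstrassCurve.shaOrder,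
      ← (Nat.pow_right_injective hpp.two_le).eq_iff, pow_add,
      ← natCard_primaryComponent_eq_pow_padicValNat p, ← natCard_primaryComponent_eq_pow_padicValNat p,
      ← natCard_primaryComponent_eq_pow_padicValNat p]
    exact hcard
  -- torsion: `v_p(#E(K)_tors) = v_p(#E(ℚ)_tors) + v_p(#E^K(ℚ)_tors)`
  obtain ⟨θ, c, hθ, hcθ⟩ := Quadratic.exists_sq_eq_algebraMap (F := ℚ) (K := K) h2
  obtain ⟨qq, hqq, hdq⟩ := NumberField.exists_discr_eq_mul_sq h2 hθ hcθ
  have htors : padicValNat p (W.baseChange K).torsionOrder =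
      padicValNat p W.torsionOrder + padicValNat p Wd.torsionOrder :=
    AdditivePotMult.padicValNat_torsionOrder_baseChange_quadratic_anyRank W K h2 hθ hcθ hqq hdq Wd
      ⟨Cd, hCd⟩ p hp2
  -- Tamagawa: `v_p(∏c(E^K)) = v_p(∏c(E))`
  have htam : padicValNat p Wd.tamagawaProduct = padicValNat p W.tamagawaProduct :=
    X2.padicValNat_tamagawaProduct_twist_of_heegner_of_odd W p hp2 K hK hodd hpd hHN' Cd hCd
  -- Manin constant prime to `p`
  have hvc : padicValInt p Dt.c = 0 := padicValInt.eq_zero_of_not_dvd hc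
  ---------------------------------------------------------------- combine
  rw [hvc] at h6
  omega

/-! ## §2. Per pair: Mazur's main conjecture from STEP L (rank-zero orientation) + the twist's upper half -/

/-- **Currency bridge (bookkeeping).** For an elliptic `Wd/ℚ` with `L^{(r)}(Wd,1) ≠ 0` (modularity
`hmod`), if Miller's analytic order of `Ш` is the rational `s` (`shaAn Wd = s`), then the print-shape
quotient `L^{(r)}(Wd,1)/(r!·Ω·Reg)` is the rational `s · ∏ c_ℓ / #Wd(ℚ)_tors²`, and
`ord_p (s · ∏c/#tors²) = ord_p s + ord_p ∏c − 2·ord_p #tors`. [cite: Miller2011LMS, Def. 1.1 and §1 (#Ш_an)] -/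
theorem quotient_eq_of_shaAn_eq (hmod : hasEntireLFunction_rat)
    (Wd : WeierstrassCurve ℚ) [Wd.IsElliptic] (p : ℕ) [Fact p.Prime] (s : ℚ) (hs : shaAn Wd = (s : ℂ)) :
    Wd.leadingLCoeff / ((Wd.realPeriodRat * Wd.regulator : ℝ) : ℂ) =
        ((s * Wd.tamagawaProduct / (Wd.torsionOrder : ℚ) ^ 2 : ℚ) : ℂ) ∧
      padicValRat p (s * Wd.tamagawaProduct / (Wd.torsionOrder : ℚ) ^ 2) =
        padicValRat p s + padicValNat p Wd.tamagawaProduct - 2 * padicValNat p Wd.torsionOrder := by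
  have hΩ : (0 : ℝ) < Wd.realPeriodRat := Wd.realPeriodRat_pos_holds
  have hR : (0 : ℝ) < Wd.regulator := Wd.regulator_pos'
  have hc0 : 0 < Wd.tamagawaProduct := Wd.tamagawaProduct_pos_holds
  have ht0 : 0 < Wd.torsionOrder := Wd.torsionOrder_pos_holds
  have hΩ' : (Wd.realPeriodRat : ℂ) ≠ 0 := by exact_mod_cast hΩ.ne'
  have hR' : (Wd.regulator : ℂ) ≠ 0 := by exact_mod_cast hR.ne'
  have hcp : (Wd.tamagawaProduct : ℂ) ≠ 0 := by exact_mod_cast hc0.ne'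
  have htp : (Wd.torsionOrder : ℂ) ≠ 0 := by exact_mod_cast ht0.ne'
  have hLne : Wd.leadingLCoeff ≠ 0 := Wd.leadingLCoeff_ne_zero_holds (hmod Wd)
  -- `s ≠ 0`
  have hs0 : s ≠ 0 := by
    rintro rfl
    rw [shaAn_def, Rat.cast_zero, div_eq_zero_iff] at hs
    rcases hs with h | h
    · exact (mul_ne_zero hLne (pow_ne_zero 2 htp)) h
    · exact (mul_ne_zero (mul_ne_zero hΩ' hcp) hR') h
  refine ⟨?_, ?_⟩
  · -- `L^{(r)}/(Ω·Reg) = s·∏c/#tors²`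
    rw [shaAn_def, div_eq_iff (mul_ne_zero (mul_ne_zero hΩ' hcp) hR')] at hs
    have hΩR : ((Wd.realPeriodRat * Wd.regulator : ℝ) : ℂ) ≠ 0 := by
      push_cast; exact mul_ne_zero hΩ' hR'
    rw [div_eq_iff hΩR]
    push_cast
    field_simp
    linear_combination hs
  · -- valuations
    have ht : (Wd.torsionOrder : ℚ) ≠ 0 := by exact_mod_cast ht0.ne'
    have hcq : (Wd.tamagawaProduct : ℚ) ≠ 0 := by exact_mod_cast hc0.ne'
    rw [padicValRat.div (mul_ne_zero hs0 hcq) (pow_ne_zero 2 ht), padicValRat.mul hs0 hcq,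
      padicValRat.pow (Wd.torsionOrder : ℚ), padicValRat.of_nat, padicValRat.of_nat]
    ring

/-- **PER PAIR: Mazur's main conjecture at an X2b-type pair from STEP L over `K` (rank-zero
orientation) and the UPPER half of `BSD(p)` at the rank-one twist.** Data: `W/ℚ` globally minimal,
`p ≠ 2` of multiplicative reduction, `E[p]` reducible, `ord_{s=1} L(E,s) = 0` (so an X2a or X2b pair;
`GVPar` is not looked at); `K`, `Dt`, `H`, `P`, `Wd` as in §1 (`K` admissible with `d_K` odd `< -4`,
`p ∤ c(Dt)`, `Wd` a globally minimal model of `E^{(d_K)}` of analytic rank one). Hypotheses BY NAME: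
STEP L `X11b.IndexLowerBoundAt W p K P` (granted `Ш(E/K)` finite) and `Typed.MissingUpperBoundAt Wd p`
(`#Ш_an(Wd)` rational with `ord_p #Ш(Wd) ≤ ord_p #Ш_an(Wd)` — the Euler-system half at the twist).
Published binders: Wuthrich 2014 Thm. 16 (`hWu`), Stein–Wuthrich Thm. 6.1 (`hJs`, `hJn`), height
existence (`hHs`, `hHn`), Greenberg–Stevens (`hGS`), GZK, modularity, Gross–Zagier, Kolyvagin.
Proof: for any rational `t = L(E,1)/Ω_E`, §1 with `q_d = #Ш_an(Wd)·∏c(Wd)/#Wd(ℚ)_tors²`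
(`quotient_eq_of_shaAn_eq`) gives `ord_p t − B(E) ≤ B(Wd) − ord_p q_d = ord_p #Ш(Wd) − ord_p #Ш_an(Wd) ≤ 0`;
then `X2.mazurMainConjectureAt_of_padicValRat_le_of_red`. [cite: Wuthrich2014, Thm. 16 and §5 (p. 397)]
[cite: JetchevSkinnerWan2017, §7.4.1 (eq:shalowerK-1)] [cite: GreenbergLNM1716, §4 (PDF pp. 112–113)]
[cite: Miller2011LMS, Def. 1.1] -/
theorem mazurMainConjectureAt_of_indexLowerBoundAt_of_upper_twist
    (hWu : thm16_charIdeal_dvd_multiplicative_of_reducible)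
    (hJs : thm61_splitMultiplicative) (hJn : thm61_nonsplitMultiplicative)
    (hHs : exists_isSplitMultCanonical) (hHn : exists_isMultCanonical)
    (hGZK : rank_eq_analyticRank_of_analyticRank_le_one) (hmod : hasEntireLFunction_rat)
    (W : WeierstrassCurve ℚ) [W.IsElliptic] [W.IsGloballyMinimal] (p : ℕ) [Fact p.Prime]
    (hGS : greenberg_stevens (W := W) (p := p))
    (N : ℕ) [NeZero N] (K : Type) [Field K] [NumberField K]
    (Dt : ModularParametrizationData W N) (H : HeegnerDatum N (NumberField.discr K)) (ι : K →+* ℂ)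
    (P : (W.baseChange K).toAffine.Point)
    (hGZ : gross_zagier N W K) (hKo : kolyvagin N W K)
    (hK : IsImaginaryQuadratic K) (hodd : Odd (NumberField.discr K)) (hlt : NumberField.discr K < -4)
    (hN : W.conductorNorm ℤ = N) (hHN : SatisfiesHeegnerHypothesis N K)
    (hHp : SatisfiesHeegnerHypothesis p K)
    (hP : WeierstrassCurve.Affine.Point.map ι.toRatAlgHom P = heegnerPointComplex Dt H)
    (hc : ¬ (p : ℤ) ∣ Dt.c)
    (hp2 : p ≠ 2) (hmult : W.HasMultiplicativeReductionAtPrime p)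
    (hred : ¬ W.HasIrreducibleModPGaloisRep p) (hr : W.analyticRank = 0)
    (Wd : WeierstrassCurve ℚ) [Wd.IsElliptic] [Wd.IsGloballyMinimal]
    (hWd : ∃ C : VariableChange ℚ, C • Wd = W.quadraticTwist (NumberField.discr K : ℚ))
    (hrd : Wd.analyticRank = 1)
    (hlow : Finite (W.baseChange K).sha → X11b.IndexLowerBoundAt W p K P)
    (hUd : MissingUpperBoundAt Wd p) :
    X2.MazurMainConjectureAt W p := by
  obtain ⟨s, hs, hus⟩ := hUd
  obtain ⟨hqd, hvqd⟩ := quotient_eq_of_shaAn_eq hmod Wd p s hs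
  refine X2.mazurMainConjectureAt_of_padicValRat_le_of_red hWu hJs hJn hHs hHn hGZK hmod W p hGS hp2
    hmult hred hr ?_
  intro t ht
  have h1 := displayLE_of_indexLowerBoundAt W p N K Dt H ι P hGZ hKo hGZK hmod hK hodd hlt hN hHN hHp hP
    hp2 hc hr Wd hWd hrd hlow t _ ht hqd
  rw [hvqd] at h1
  omega

end Summit.BirchSwinnertonDyer.BirchSwinnertonDyer.Theorems.EisensteinPrimesMazurMCOnCellBTwistbackLowerHalf

end
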